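import Literature.NumberTheory.GaloisRepresentations.LAdicRepFrobenius
import Literature.RepresentationTheory.Semisimple.BrauerNesbitt
import HarnessLib

/-!
# Semisimple Galois representations over a DISCRETE field (e.g. mod `p`) are determined by their
# Frobenius characteristic polynomials (Deligne–Serre 1974, Lemme 3.2, cases (a)–(b))

Topic `Literature/NumberTheory/GaloisRepresentations`, sibling of `LAdicRepFrobenius`
(`FramedGaloisRep.nonempty_equiv_of_hasFrobCharpolyAt_eventually`: the same uniqueness statement over
a Hausdorff field of CHARACTERISTIC ZERO, via traces).  Deligne–Serre, *Formes modulaires de poids 1*,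
§3.1 (p. 513) consider continuous `ρ : G → GL_n(k)` "où `k` est de l'un des types suivants : (a) le
corps `ℂ` (avec la topologie discrète); (b) un corps fini (avec la topologie discrète); (c) une
extension finie d'un corps `ℓ`-adique", and prove **Lemme 3.2** (p. 513): "Soit `X` un ensemble de
nombres premiers de densité `1` et soient `ρ` et `ρ'` deux représentations linéaires semi-simples de
`G`.  Supposons que, pour tout `p ∈ X`, `ρ` et `ρ'` soient non ramifiées, et que
`P_{p,ρ}(T) = P_{p,ρ'}(T)` (resp. que `Tr(F_{p,ρ}) = Tr(F_{p,ρ'})` lorsque `k` est de caractéristique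
`0`).  Alors `ρ` et `ρ'` sont isomorphes. — Cela résulte du théorème de densité de Čebotarev, combiné
avec le fait qu'une représentation linéaire semi-simple d'un groupe est déterminée, à isomorphisme
près, par les polynômes caractéristiques (resp. les traces, si la caractéristique du corps est `0`)
correspondants ([3], §30.16)."

This file proves the CHARACTERISTIC-POLYNOMIAL form for coefficient fields with the DISCRETE
topology (cases (a), (b): in particular `k` finite or `k = 𝔽̄_p` discrete, the tree's
`ModPGaloisRep K k n = FramedGaloisRep K k n`), over any number field `K` and with "density one"
specialised to "all but finitely many places" (the tree's convention, as in `LAdicRepFrobenius`):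

* `FramedGaloisRep.charpoly_eq_of_hasFrobCharpolyAt_eventually` — for continuous
  `r, r' : Γ_K → GL_n(A)`, `A` a field with the discrete topology, unramified with a common
  characteristic polynomial of arithmetic Frobenius at all but finitely many finite places, the
  characteristic polynomials of `r(σ)` and `r'(σ)` agree for EVERY `σ ∈ Γ_K` (no semisimplicity
  needed): the coincidence set is closed (both maps are continuous into a discrete space) and
  contains the dense set of good Frobenii (`absoluteGaloisGroup.frobenius_dense`, from the named fact
  `Automorphic.chebotarev_artinRep`, hypothesis `hC` — discharged in the tree by
  `Automorphic.chebotarev_artinRep_holds`);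
* `FramedGaloisRep.nonempty_equiv_of_hasFrobCharpolyAt_eventually_of_discrete` — **Lemme 3.2**: if
  moreover `r`, `r'` are semisimple they are isomorphic (Brauer–Nesbitt in the characteristic-free
  form of the tree, `Literature.RepresentationTheory.Semisimple.Representation.nonempty_equiv_of_charpoly_eq`,
  Bourbaki A VIII § 20 n° 6); finite-exceptional-set form `…_of_finite_of_discrete`;
* `FramedGaloisRep.infinite_setOf_not_hasFrobCharpolyAt_of_isEmpty_equiv` — contrapositive:
  two NON-isomorphic semisimple representations differ (fail to be unramified with a common
  Frobenius polynomial) at INFINITELY many places; used to separate a given `ρ̄` from finitely many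
  others by finitely many Frobenius polynomials (e.g. `ρ̄_{E,3}` of Serre weight `6` from the mod-`3`
  representations of weight-two eigenforms of a fixed level, route `TameQuarticManinParity`, item H1).

Not here: the trace form in characteristic `0` (that is `LAdicRepFrobenius`), case (c)
(`ℓ`-adic fields: also `LAdicRepFrobenius`), density-one sets of primes other than cofinite ones.

## References

* P. Deligne, J.-P. Serre, *Formes modulaires de poids 1*, Ann. Sci. ÉNS (4) 7 (1974), 507–530:
  §3.1 and Lemme 3.2 (p. 513), Remarque 3.3. [DeligneSerreASENS1974]
* N. Bourbaki, *Algèbre* VIII (2012), § 20 n° 6, Thm. 2, Cor. 1 (p. 378) (Brauer–Nesbitt).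
  [BourbakiAlgebreVIII2012]
* J.-P. Serre, *Abelian ℓ-adic representations and elliptic curves* (1968), Ch. I §2.2, Cor. 2 (a)
  (density of Frobenii). [SerreAbelianLadic1968]
-/

noncomputable section

open scoped NumberField
open IsDedekindDomain Field

namespace Literature.NumberTheory.GaloisRepresentations

section Discrete

variable {K : Type} [Field K] [NumberField K] {A : Type*} [Field A] [TopologicalSpace A]
  {n : ℕ}

omit [NumberField K] in
/-- The characteristic polynomial of `σ` in the representation on `Aⁿ` underlying a framed Galois
representation is the matrix characteristic polynomial `FramedRep.charpoly` (Mathlib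
`Matrix.charpoly_toLin'`). [folklore] -/
private theorem FramedGaloisRep.charpoly_toRepresentation [IsTopologicalRing A]
    (r : FramedGaloisRep K A n)
    (σ : absoluteGaloisGroup K) :
    (r.toGaloisRep.toRepresentation σ).charpoly = FramedRep.charpoly r σ := by
  have h : r.toGaloisRep.toRepresentation σ =
      Matrix.toLin' ((r σ : GL (Fin n) A) : Matrix (Fin n) (Fin n) A) := by
    apply LinearMap.ext
    intro v
    rw [FramedRep.toContinuousRep_toRepresentation, FramedRep.toRepresentation_apply_apply,
      Matrix.toLin'_apply]
  rw [h, Matrix.charpoly_toLin']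
  rfl

/-- **Frobenius characteristic polynomials determine all characteristic polynomials, over a
discrete coefficient field** (Deligne–Serre 1974, proof of Lemme 3.2, cases (a)–(b) of §3.1: "Cela
résulte du théorème de densité de Čebotarev …").  For a number field `K`, a field `A` with the
DISCRETE topology and continuous `r, r' : Γ_K → GL_n(A)` such that for all but finitely many finite
places `v` both are unramified at `v` with a common characteristic polynomial of arithmetic
Frobenius, `det(X − r(σ)) = det(X − r'(σ))` for every `σ ∈ Γ_K`.  Proof: the coincidence set is the
preimage of a subset of the discrete space `M_n(A) × M_n(A)` under a continuous map, hence closed,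
and contains the dense set of good Frobenii (`absoluteGaloisGroup.frobenius_dense`, from
`Automorphic.chebotarev_artinRep`, hypothesis `hC`).  No semisimplicity is needed here.
[cite: DeligneSerreASENS1974, §3.1 and Lemme 3.2 (p. 513)] -/
theorem FramedGaloisRep.charpoly_eq_of_hasFrobCharpolyAt_eventually [DiscreteTopology A]
    (hC : Automorphic.chebotarev_artinRep) (r r' : FramedGaloisRep K A n)
    (h : ∀ᶠ v : HeightOneSpectrum (𝓞 K) in Filter.cofinite,
      r.IsUnramifiedAt v ∧ r'.IsUnramifiedAt v ∧
        ∃ P : Polynomial A, r.HasFrobCharpolyAt v P ∧ r'.HasFrobCharpolyAt v P)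
    (σ : absoluteGaloisGroup K) :
    FramedRep.charpoly r σ = FramedRep.charpoly r' σ := by
  classical
  set S : Set (HeightOneSpectrum (𝓞 K)) := {v | ¬ (r.IsUnramifiedAt v ∧ r'.IsUnramifiedAt v ∧
      ∃ P : Polynomial A, r.HasFrobCharpolyAt v P ∧ r'.HasFrobCharpolyAt v P)} with hSdef
  have hS : S.Finite := Filter.eventually_cofinite.1 h
  set D : Set (absoluteGaloisGroup K) :=
    {σ | ∃ v ∉ S, ∃ 𝔓 ∈ v.primesAbove, IsArithFrobAt (𝓞 K) σ 𝔓} with hDdef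
  -- characteristic polynomials agree on the Frobenius elements over good places
  have hF : D ⊆ {σ | FramedRep.charpoly r σ = FramedRep.charpoly r' σ} := by
    rintro τ ⟨v, hv, 𝔓, h𝔓, hτ⟩
    simp only [hSdef, Set.mem_setOf_eq, not_not] at hv
    obtain ⟨-, -, P, hP, hP'⟩ := hv
    have h1 : FramedRep.charpoly r τ = P := hP 𝔓 h𝔓 τ hτ
    have h2 : FramedRep.charpoly r' τ = P := hP' 𝔓 h𝔓 τ hτ
    show FramedRep.charpoly r τ = FramedRep.charpoly r' τ
    rw [h1, h2]
  -- the coincidence set is closed: preimage of a subset of a discrete space under a continuous map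
  have hcont : Continuous fun τ : absoluteGaloisGroup K ↦
      (((r τ : GL (Fin n) A) : Matrix (Fin n) (Fin n) A),
        ((r' τ : GL (Fin n) A) : Matrix (Fin n) (Fin n) A)) :=
    (Units.continuous_val.comp (map_continuous r)).prodMk
      (Units.continuous_val.comp (map_continuous r'))
  have hclosed : IsClosed {τ : absoluteGaloisGroup K |
      FramedRep.charpoly r τ = FramedRep.charpoly r' τ} := by
    have hset : {τ : absoluteGaloisGroup K | FramedRep.charpoly r τ = FramedRep.charpoly r' τ} =
        (fun τ : absoluteGaloisGroup K ↦
          (((r τ : GL (Fin n) A) : Matrix (Fin n) (Fin n) A),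
            ((r' τ : GL (Fin n) A) : Matrix (Fin n) (Fin n) A))) ⁻¹'
          {q : Matrix (Fin n) (Fin n) A × Matrix (Fin n) (Fin n) A | q.1.charpoly = q.2.charpoly} :=
      rfl
    rw [hset]
    exact (isClosed_discrete _).preimage hcont
  have hmem : σ ∈ closure D := by
    rw [(absoluteGaloisGroup.frobenius_dense hC K S hS).closure_eq]
    exact Set.mem_univ σ
  exact hclosed.closure_subset_iff.2 hF hmem

/-- **Deligne–Serre 1974, Lemme 3.2 (characteristic-polynomial form, discrete coefficients):
semisimple Galois representations with the same Frobenius characteristic polynomials at almost all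
places are isomorphic.**  For a number field `K`, a field `A` with the discrete topology (e.g. `A`
finite, or an algebraic closure of `𝔽_p` — Deligne–Serre's cases (a) `ℂ` discrete, (b) `k` fini)
and continuous semisimple `r, r' : Γ_K → GL_n(A)` such that for all but finitely many finite places
`v` both are unramified with a common characteristic polynomial of arithmetic Frobenius at `v`, there
is an isomorphism of the underlying continuous representations.  Proof as printed: Čebotarev
(`charpoly_eq_of_hasFrobCharpolyAt_eventually`) + "une représentation linéaire semi-simple d'un groupe
est déterminée, à isomorphisme près, par les polynômes caractéristiques" (Brauer–Nesbitt, any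
characteristic: the tree's `Representation.nonempty_equiv_of_charpoly_eq`); the equivalence is
bicontinuous on `Fin n → A` (`LinearMap.continuous_on_pi`).  Printed for `K = ℚ` and a density-one
set of primes; tree reading: any number field, cofinitely many places.
[cite: DeligneSerreASENS1974, Lemme 3.2 (p. 513)] -/
theorem FramedGaloisRep.nonempty_equiv_of_hasFrobCharpolyAt_eventually_of_discrete [IsTopologicalRing A]
    [DiscreteTopology A]
    (hC : Automorphic.chebotarev_artinRep)
    (r r' : FramedGaloisRep K A n)
    (hr : r.toGaloisRep.IsSemisimple) (hr' : r'.toGaloisRep.IsSemisimple)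
    (h : ∀ᶠ v : HeightOneSpectrum (𝓞 K) in Filter.cofinite,
      r.IsUnramifiedAt v ∧ r'.IsUnramifiedAt v ∧
        ∃ P : Polynomial A, r.HasFrobCharpolyAt v P ∧ r'.HasFrobCharpolyAt v P) :
    Nonempty (ContinuousRep.Equiv r.toGaloisRep r'.toGaloisRep) := by
  have hall := FramedGaloisRep.charpoly_eq_of_hasFrobCharpolyAt_eventually hC r r' h
  have h' : ∀ σ : absoluteGaloisGroup K,
      (r.toGaloisRep.toRepresentation σ).charpoly = (r'.toGaloisRep.toRepresentation σ).charpoly := by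
    intro σ
    rw [FramedGaloisRep.charpoly_toRepresentation, FramedGaloisRep.charpoly_toRepresentation, hall σ]
  haveI : r.toGaloisRep.toRepresentation.IsSemisimpleRepresentation := hr
  haveI : r'.toGaloisRep.toRepresentation.IsSemisimpleRepresentation := hr'
  obtain ⟨e⟩ :=
    Literature.RepresentationTheory.Semisimple.Representation.nonempty_equiv_of_charpoly_eq _ _ h'
  exact ⟨⟨e, LinearMap.continuous_on_pi e.toLinearEquiv.toLinearMap,
    LinearMap.continuous_on_pi e.toLinearEquiv.symm.toLinearMap⟩⟩

/-- Finite-exceptional-set form of `nonempty_equiv_of_hasFrobCharpolyAt_eventually_of_discrete`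
(Deligne–Serre, Remarque 3.3: "`X` = the primes not dividing a given `N`").
[cite: DeligneSerreASENS1974, Lemme 3.2 and Remarque 3.3 (p. 513)] -/
theorem FramedGaloisRep.nonempty_equiv_of_hasFrobCharpolyAt_of_finite_of_discrete [IsTopologicalRing A]
    [DiscreteTopology A]
    (hC : Automorphic.chebotarev_artinRep) {S : Set (HeightOneSpectrum (𝓞 K))} (hS : S.Finite)
    (r r' : FramedGaloisRep K A n)
    (hr : r.toGaloisRep.IsSemisimple) (hr' : r'.toGaloisRep.IsSemisimple)
    (hST : ∀ v ∉ S, r.IsUnramifiedAt v ∧ r'.IsUnramifiedAt v ∧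
      ∃ P : Polynomial A, r.HasFrobCharpolyAt v P ∧ r'.HasFrobCharpolyAt v P) :
    Nonempty (ContinuousRep.Equiv r.toGaloisRep r'.toGaloisRep) :=
  FramedGaloisRep.nonempty_equiv_of_hasFrobCharpolyAt_eventually_of_discrete hC r r' hr hr'
    (Filter.mem_of_superset hS.compl_mem_cofinite fun v hv ↦ hST v hv)

/-- **Non-isomorphic semisimple representations are separated by Frobenius polynomials at
infinitely many places** (contrapositive of Lemme 3.2, discrete coefficients): if `r`, `r'` are
semisimple and NOT isomorphic, the set of finite places at which they fail to be unramified with a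
common characteristic polynomial of Frobenius is infinite — so it meets the complement of any finite
set (e.g. of the ramified places), giving an unramified place with DIFFERENT Frobenius polynomials.
[cite: DeligneSerreASENS1974, Lemme 3.2 (p. 513)] -/
theorem FramedGaloisRep.infinite_setOf_not_hasFrobCharpolyAt_of_isEmpty_equiv [IsTopologicalRing A]
    [DiscreteTopology A]
    (hC : Automorphic.chebotarev_artinRep)
    (r r' : FramedGaloisRep K A n)
    (hr : r.toGaloisRep.IsSemisimple) (hr' : r'.toGaloisRep.IsSemisimple)
    (hne : IsEmpty (ContinuousRep.Equiv r.toGaloisRep r'.toGaloisRep)) :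
    {v : HeightOneSpectrum (𝓞 K) | ¬ (r.IsUnramifiedAt v ∧ r'.IsUnramifiedAt v ∧
      ∃ P : Polynomial A, r.HasFrobCharpolyAt v P ∧ r'.HasFrobCharpolyAt v P)}.Infinite := by
  intro hfin
  have h : ∀ᶠ v : HeightOneSpectrum (𝓞 K) in Filter.cofinite,
      r.IsUnramifiedAt v ∧ r'.IsUnramifiedAt v ∧
        ∃ P : Polynomial A, r.HasFrobCharpolyAt v P ∧ r'.HasFrobCharpolyAt v P :=
    Filter.eventually_cofinite.2 hfin
  obtain ⟨e⟩ := FramedGaloisRep.nonempty_equiv_of_hasFrobCharpolyAt_eventually_of_discrete hC r r'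
    hr hr' h
  exact hne.false e

/-- The same separation statement relative to a finite set `S` of places to be avoided (e.g. the
places where `r` or `r'` ramifies): two non-isomorphic semisimple representations over a discrete
field admit a place `v ∉ S` at which they are NOT both unramified with a common Frobenius
polynomial. [cite: DeligneSerreASENS1974, Lemme 3.2 and Remarque 3.3 (p. 513)] -/
theorem FramedGaloisRep.exists_not_hasFrobCharpolyAt_of_isEmpty_equiv [IsTopologicalRing A]
    [DiscreteTopology A]
    (hC : Automorphic.chebotarev_artinRep) {S : Set (HeightOneSpectrum (𝓞 K))} (hS : S.Finite)
    (r r' : FramedGaloisRep K A n)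
    (hr : r.toGaloisRep.IsSemisimple) (hr' : r'.toGaloisRep.IsSemisimple)
    (hne : IsEmpty (ContinuousRep.Equiv r.toGaloisRep r'.toGaloisRep)) :
    ∃ v ∉ S, ¬ (r.IsUnramifiedAt v ∧ r'.IsUnramifiedAt v ∧
      ∃ P : Polynomial A, r.HasFrobCharpolyAt v P ∧ r'.HasFrobCharpolyAt v P) := by
  obtain ⟨v, hv, hvS⟩ :=
    ((FramedGaloisRep.infinite_setOf_not_hasFrobCharpolyAt_of_isEmpty_equiv hC r r' hr hr'
      hne).sdiff hS).nonempty
  exact ⟨v, hvS, hv⟩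

end Discrete

end Literature.NumberTheory.GaloisRepresentations

end
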